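/-
Copyright: the b2b-balaban T⁴-continuum CRUX team, row NE7b leaf lineage `t4-ne7b-formalise-leaf-06` (gen 158). Project licence.
-/
import Literature.MathematicalPhysics.QuantumFieldTheory.Balaban1983to89.B5Hk103ScalarZd

/-!
# THE BLOCK-AVERAGED MASSIVE PROPAGATOR `G′ = (Δ^η + aQ′*Q′)⁻¹` IN THE MIXED CURRENCY `ℓ^∞(blocks; block-RMS) → ℓ^∞(blocks; block-RMS)`:
# `RMS_{B(y″)}(G′_Wψ) ≤ c_u·Σ_{y′∈W}e^{−δ_u·dist(y″,y′)}·RMS_{B(y′)}(ψ) ≤ c_u(d,a)·K_d(δ_u(d,a))·sup_{y′}RMS_{B(y′)}(ψ)` — UNIFORMLY IN THE MESH,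
# EVERY `d`, constants the tree's displayed `cU ∕ deltaU`
# (row NE7b, node U5c; the `G′`-column companion of `…OneShotChartMixedNorm`; [folklore] duality over `B6QGQDecay237.gPrime_setDecay` BY NAME)

Cell `pub-balaban`, sub-cell `t4`, spine estimate NE7b (`T4WeightBudget.RelWeightBound`; the cell's OWN estimate — NOT PRINTED in
[Bałaban 1983–89], NOT PROVED).  Crux-route work under `Spine/NE7b/` by leaf-06 (CRUX team (2), FREEZE (0) crux-prover clause).
NOTHING of Bałaban's is named as a Lean object, valued or asserted; no `T4Continuum/Support` leaf typed; no `def`; zero `sorry`.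
Import: `Literature.….B5Hk103ScalarZd` ONLY (through it `B6QGQDecay237`: the B4-Sect.-5 inverse kernel `Gk n a p q` of the site matrix
`Aker n a = Δ^η + aQ′*Q′` on the whole lattice, its block-to-block `ℓ²` Combes–Thomas bound `gPrime_setDecay` with the mesh-free constant
`2∕min(2,a)` and rate `δ_u∕(n+1)` in site distance, `dist_blk_ge`, `cU = (2∕min(2,a))·e^{δ_u}`, `deltaU`, and `B4Sect5Proof.latticeSum_le`).

WHY.  The OWNER's RULING W-ne7bp1-g113-3 (journal [NE7bP1-G113-RULING3]) reads the hard-step cell's radius letter OF RECORD in the MIXED currency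
`ℓ^∞(coarse) → ℓ^∞(blocks; block-RMS)` of PRICING-NE7b v122 F727 (d), where the one-shot chart letter holds BY VALUE at every side `M ≥ 2`; its
item (5): «the `T⁻¹` letters transfer: the section column is [`kerH_blockRMS_le` ∕ `…OneShotChartMixedNorm`]; the fibre-inverse column needs
`‖G′‖_{mix→mix}` — by name from the block-to-block `ℓ²` Combes–Thomas bound `B6QGQDecay237.gPrime_setDecay` … exactly as (49)∕(51) did in sup —
OPEN».  THIS FILE is that column: the same self-duality trick as `…OneShotChartMixedNorm` §2 (test the block-to-block letter against
`f := (G′ψ)|_{B(y″)}`, source block by source block) turns `gPrime_setDecay` into the mixed operator letter with the tree's displayed constants,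
for every `d` and every mesh.  A by-value closure at fixed `(d, M)` goes through the companion's abstract SDP-dual shape
`…OneShotChartMixedNorm.sdpDual_certificate` with `Z := B n y″`, `h p q := Gk n a p q` VERBATIM (not restated here).

WHAT IS PROVED (`a > 0`; `Gk n a p q` the kernel of `G′`; finite coarse windows `W`; `G′_Wψ := Σ_{y′∈W}Σ_{q∈B(y′)}G′(·,q)ψ(q)`; all [folklore]):
* §1 `abs_sum_sum_Gk_le_blocks` (two blocks: `|Σ_{p∈B(y″)}Σ_{q∈B(y′)}f_pG′(p,q)g_q| ≤ c_u·e^{−δ_u·dist(y″,y′)}·‖f‖₂‖g‖₂` — `gPrime_setDecay` at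
  `R = (n+1)dist(y″,y′) − n`), `sum_sq_Gpsi_le_mul_sqrt` (duality on the target block), **`blockRMS_Gpsi_le_weighted`**
  (`RMS_{B(y″)}(G′_Wψ) ≤ c_u·Σ_{y′∈W}e^{−δ_u dist(y″,y′)}·RMS_{B(y′)}(ψ)`).
* §2 **`blockRMS_Gpsi_le_mix`** (`RMS_{B(y′)}(ψ) ≤ ρ` on `W`, `0 ≤ ρ` ⇒ `RMS_{B(y″)}(G′_Wψ) ≤ c_u(d,a)·K_d(δ_u(d,a))·ρ`) — THE MIXED OPERATOR LETTER
  `‖G′‖_{mix→mix} ≤ c_u·K_d(δ_u)`, every `d`, every mesh, finite windows.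

HONEST: §2's constant is the `B6QGQDecay237` family (crude; EMPTY by value against any threshold of record); which currency is of record is the
OWNER's ruling, not this file; `ℤ^d` object, no torus, nothing of (A3) ∕ NC-NE7b-α.  BY-NAME EFFECT ON THE WALL: NONE.  NE7b NOT PRINTED ∕
NOT PROVED; spine PROVED 0∕9; rung (B)+1 on a FINITE torus — NOT infinite volume, NOT the mass gap, NOT Clay.  HONEST DEPENDENCY: continuum
YM on T⁴ ⇐ BetaPertH ∧ nine spine estimates (0∕9 proved); BetaPertH ⇐ (D1) ∧ (D4) ∧ CAP+tail; G-an2-4 gates asym, D1 and NE2∕3∕4.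
-/

set_option autoImplicit false

namespace Summit.QuantumFields.BalabanUV.T4Continuum.NE7b.BlockPropagatorMixedNorm

open Finset
open Literature.MathematicalPhysics.QuantumFieldTheory.Balaban1983to89
open B4Sect5Proof (latticeConst latticeSum_le latticeConst_nonneg)
open B4Sect5Exhaustion (limInv)
open B6QGQLower276 (X B Aker)
open B6QGQDecay237 (gPrime_setDecay dist_blk_ge cU deltaU deltaU_pos cU_pos)
open B5Hk103ScalarZd (Gk)

variable {d : ℕ}

/-! ## §1. Block to block, and the weighted mixed letter -/

/-- **TWO BLOCKS**: `|Σ_{p∈B(y″)}Σ_{q∈B(y′)} f_p·G′(p,q)·g_q| ≤ c_u(d,a)·e^{−δ_u·dist(y″,y′)}·‖f‖₂·‖g‖₂` — the tree's block-to-block `ℓ²`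
Combes–Thomas bound `gPrime_setDecay` at site separation `R = (n+1)·dist(y″,y′) − n` (`dist_blk_ge`), the factor `e^{δ_u n∕(n+1)} ≤ e^{δ_u}`
absorbed in `c_u = (2∕min(2,a))·e^{δ_u}`. [folklore] -/
theorem abs_sum_sum_Gk_le_blocks (n : ℕ) {a : ℝ} (ha : 0 < a) (y'' y' : X d) (f g : X d → ℝ) :
    |∑ p ∈ B n y'', ∑ q ∈ B n y', f p * Gk n a p q * g q|
      ≤ cU d a * Real.exp (-(deltaU d a * dist y'' y'))
        * Real.sqrt (∑ p ∈ B n y'', f p ^ 2) * Real.sqrt (∑ q ∈ B n y', g q ^ 2) := by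
  have h := gPrime_setDecay n ha Set.univ (B n y'') (B n y') (Set.subset_univ _) (Set.subset_univ _)
    (((n : ℝ) + 1) * dist y'' y' - n) (fun p hp q hq => dist_blk_ge hp hq) f g
  have hG : ∑ p ∈ B n y'', ∑ q ∈ B n y', f p * limInv Set.univ (Aker n a) (p, 0) (q, 0) * g q
      = ∑ p ∈ B n y'', ∑ q ∈ B n y', f p * Gk n a p q * g q := rfl
  rw [hG] at h
  refine h.trans ?_
  have hn1 : (0 : ℝ) < (n : ℝ) + 1 := by positivity
  have hδ := deltaU_pos d ha
  have hexp : Real.exp (-(deltaU d a * ((((n : ℝ) + 1) * dist y'' y' - n) / ((n : ℝ) + 1))))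
      ≤ Real.exp (deltaU d a) * Real.exp (-(deltaU d a * dist y'' y')) := by
    rw [← Real.exp_add]
    apply Real.exp_le_exp.mpr
    have hfrac : (((n : ℝ) + 1) * dist y'' y' - n) / ((n : ℝ) + 1) = dist y'' y' - n / ((n : ℝ) + 1) := by
      field_simp
    rw [hfrac]
    have : (n : ℝ) / ((n : ℝ) + 1) ≤ 1 := by rw [div_le_one hn1]; linarith
    nlinarith [hδ, this]
  have hσ : 0 < min 2 a := lt_min two_pos ha
  calc 2 / min 2 a * Real.exp (-(deltaU d a * ((((n : ℝ) + 1) * dist y'' y' - n) / ((n : ℝ) + 1))))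
        * Real.sqrt (∑ p ∈ B n y'', f p ^ 2) * Real.sqrt (∑ q ∈ B n y', g q ^ 2)
      ≤ 2 / min 2 a * (Real.exp (deltaU d a) * Real.exp (-(deltaU d a * dist y'' y')))
        * Real.sqrt (∑ p ∈ B n y'', f p ^ 2) * Real.sqrt (∑ q ∈ B n y', g q ^ 2) := by
        gcongr
    _ = cU d a * Real.exp (-(deltaU d a * dist y'' y'))
        * Real.sqrt (∑ p ∈ B n y'', f p ^ 2) * Real.sqrt (∑ q ∈ B n y', g q ^ 2) := by
        unfold cU; ring

/-- **DUALITY ON THE TARGET BLOCK**: with `F = G′_Wψ` restricted to `B(y″)`,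
`Σ_{p∈B(y″)}F_p² ≤ (c_u·Σ_{y′∈W}e^{−δ_u dist(y″,y′)}·‖ψ|_{B(y′)}‖₂)·√(Σ_{p∈B(y″)}F_p²)`. [folklore] -/
theorem sum_sq_Gpsi_le_mul_sqrt (n : ℕ) {a : ℝ} (ha : 0 < a) (y'' : X d) (W : Finset (X d)) (ψ : X d → ℝ) :
    ∑ p ∈ B n y'', (∑ y' ∈ W, ∑ q ∈ B n y', Gk n a p q * ψ q) ^ 2
      ≤ (cU d a * ∑ y' ∈ W, Real.exp (-(deltaU d a * dist y'' y')) * Real.sqrt (∑ q ∈ B n y', ψ q ^ 2))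
        * Real.sqrt (∑ p ∈ B n y'', (∑ y' ∈ W, ∑ q ∈ B n y', Gk n a p q * ψ q) ^ 2) := by
  set F : X d → ℝ := fun p => ∑ y' ∈ W, ∑ q ∈ B n y', Gk n a p q * ψ q with hF
  have hswap : ∑ p ∈ B n y'', F p ^ 2 = ∑ y' ∈ W, ∑ p ∈ B n y'', ∑ q ∈ B n y', F p * Gk n a p q * ψ q := by
    calc ∑ p ∈ B n y'', F p ^ 2 = ∑ p ∈ B n y'', ∑ y' ∈ W, ∑ q ∈ B n y', F p * Gk n a p q * ψ q := by
          refine Finset.sum_congr rfl fun p _ => ?_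
          rw [sq, hF, Finset.mul_sum]
          refine Finset.sum_congr rfl fun y' _ => ?_
          rw [Finset.mul_sum]
          exact Finset.sum_congr rfl fun q _ => by ring
      _ = ∑ y' ∈ W, ∑ p ∈ B n y'', ∑ q ∈ B n y', F p * Gk n a p q * ψ q := Finset.sum_comm
  have hcol : ∀ y' ∈ W, ∑ p ∈ B n y'', ∑ q ∈ B n y', F p * Gk n a p q * ψ q
      ≤ cU d a * Real.exp (-(deltaU d a * dist y'' y')) * Real.sqrt (∑ p ∈ B n y'', F p ^ 2)
          * Real.sqrt (∑ q ∈ B n y', ψ q ^ 2) :=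
    fun y' _ => (le_abs_self _).trans (abs_sum_sum_Gk_le_blocks n ha y'' y' F ψ)
  calc ∑ p ∈ B n y'', F p ^ 2 = ∑ y' ∈ W, ∑ p ∈ B n y'', ∑ q ∈ B n y', F p * Gk n a p q * ψ q := hswap
    _ ≤ ∑ y' ∈ W, cU d a * Real.exp (-(deltaU d a * dist y'' y')) * Real.sqrt (∑ p ∈ B n y'', F p ^ 2)
          * Real.sqrt (∑ q ∈ B n y', ψ q ^ 2) := Finset.sum_le_sum hcol
    _ = (cU d a * ∑ y' ∈ W, Real.exp (-(deltaU d a * dist y'' y')) * Real.sqrt (∑ q ∈ B n y', ψ q ^ 2))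
          * Real.sqrt (∑ p ∈ B n y'', F p ^ 2) := by
        rw [Finset.mul_sum, Finset.sum_mul]
        exact Finset.sum_congr rfl fun y' _ => by ring

/-- **THE MIXED OPERATOR LETTER, WEIGHTED FORM**: `RMS_{B(y″)}(G′_Wψ) ≤ c_u(d,a)·Σ_{y′∈W}e^{−δ_u·dist(y″,y′)}·RMS_{B(y′)}(ψ)` — every `d`, every mesh,
every block, every finite window (the `(n+1)^{−d∕2}` normalisations on the two sides match). [folklore] -/
theorem blockRMS_Gpsi_le_weighted (n : ℕ) {a : ℝ} (ha : 0 < a) (y'' : X d) (W : Finset (X d)) (ψ : X d → ℝ) :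
    Real.sqrt ((((n : ℝ) + 1) ^ d)⁻¹ * ∑ p ∈ B n y'', (∑ y' ∈ W, ∑ q ∈ B n y', Gk n a p q * ψ q) ^ 2)
      ≤ cU d a * ∑ y' ∈ W, Real.exp (-(deltaU d a * dist y'' y'))
          * Real.sqrt ((((n : ℝ) + 1) ^ d)⁻¹ * ∑ q ∈ B n y', ψ q ^ 2) := by
  have hN : (0 : ℝ) < ((n : ℝ) + 1) ^ d := by positivity
  have hNinv : 0 ≤ (((n : ℝ) + 1) ^ d)⁻¹ := inv_nonneg.mpr hN.le
  set S := ∑ p ∈ B n y'', (∑ y' ∈ W, ∑ q ∈ B n y', Gk n a p q * ψ q) ^ 2 with hS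
  set A := cU d a * ∑ y' ∈ W, Real.exp (-(deltaU d a * dist y'' y')) * Real.sqrt (∑ q ∈ B n y', ψ q ^ 2) with hAdef
  have hA : 0 ≤ A := by
    have := (cU_pos d ha).le
    exact mul_nonneg this (Finset.sum_nonneg fun _ _ => by positivity)
  have h0 : S ≤ A * Real.sqrt S := sum_sq_Gpsi_le_mul_sqrt n ha y'' W ψ
  -- self-duality: `S ≤ A√S ⇒ √S ≤ A`
  have h1 : Real.sqrt S ≤ A := by
    by_cases hS' : S ≤ 0
    · rw [Real.sqrt_eq_zero'.mpr hS']; exact hA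
    · rw [not_le] at hS'
      have hsq : 0 < Real.sqrt S := Real.sqrt_pos.mpr hS'
      have : Real.sqrt S * Real.sqrt S ≤ A * Real.sqrt S := by rw [Real.mul_self_sqrt hS'.le]; exact h0
      exact le_of_mul_le_mul_right this hsq
  -- distribute the normalisation `√((n+1)^{−d})` over the window sum
  rw [Real.sqrt_mul hNinv]
  have e : cU d a * ∑ y' ∈ W, Real.exp (-(deltaU d a * dist y'' y'))
          * Real.sqrt ((((n : ℝ) + 1) ^ d)⁻¹ * ∑ q ∈ B n y', ψ q ^ 2)
      = Real.sqrt ((((n : ℝ) + 1) ^ d)⁻¹) * A := by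
    rw [hAdef, Finset.mul_sum, Finset.mul_sum, Finset.mul_sum]
    refine Finset.sum_congr rfl fun y' _ => ?_
    rw [Real.sqrt_mul hNinv]; ring
  rw [e]
  exact mul_le_mul_of_nonneg_left h1 (Real.sqrt_nonneg _)

/-! ## §2. The mixed operator letter, sup form -/

/-- **`‖G′‖_{mix→mix} ≤ c_u(d,a)·K_d(δ_u(d,a))`, EVERY `d`, EVERY MESH** (finite windows): if `RMS_{B(y′)}(ψ) ≤ ρ` for `y′ ∈ W` (`0 ≤ ρ`), then
`RMS_{B(y″)}(G′_Wψ) ≤ c_u·K_d(δ_u)·ρ` for every block `y″` (`B4Sect5Proof.latticeSum_le`). [folklore] -/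
theorem blockRMS_Gpsi_le_mix (n : ℕ) {a : ℝ} (ha : 0 < a) (y'' : X d) (W : Finset (X d)) (ψ : X d → ℝ) {ρ : ℝ}
    (hρ : 0 ≤ ρ) (hψ : ∀ y' ∈ W, Real.sqrt ((((n : ℝ) + 1) ^ d)⁻¹ * ∑ q ∈ B n y', ψ q ^ 2) ≤ ρ) :
    Real.sqrt ((((n : ℝ) + 1) ^ d)⁻¹ * ∑ p ∈ B n y'', (∑ y' ∈ W, ∑ q ∈ B n y', Gk n a p q * ψ q) ^ 2)
      ≤ cU d a * latticeConst d (deltaU d a) * ρ := by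
  refine (blockRMS_Gpsi_le_weighted n ha y'' W ψ).trans ?_
  have hδ := deltaU_pos d ha
  have hc := (cU_pos d ha).le
  calc cU d a * ∑ y' ∈ W, Real.exp (-(deltaU d a * dist y'' y'))
          * Real.sqrt ((((n : ℝ) + 1) ^ d)⁻¹ * ∑ q ∈ B n y', ψ q ^ 2)
      ≤ cU d a * ∑ y' ∈ W, Real.exp (-(deltaU d a * dist y'' y')) * ρ := by
        refine mul_le_mul_of_nonneg_left (Finset.sum_le_sum fun y' hy' => ?_) hc
        exact mul_le_mul_of_nonneg_left (hψ y' hy') (Real.exp_pos _).le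
    _ = cU d a * ρ * ∑ y' ∈ W, Real.exp (-(deltaU d a * dist y'' y')) := by rw [← Finset.sum_mul]; ring
    _ ≤ cU d a * ρ * latticeConst d (deltaU d a) :=
        mul_le_mul_of_nonneg_left (latticeSum_le d hδ W y'') (mul_nonneg hc hρ)
    _ = cU d a * latticeConst d (deltaU d a) * ρ := by ring

end Summit.QuantumFields.BalabanUV.T4Continuum.NE7b.BlockPropagatorMixedNorm
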